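import Mathlib

/-!
# SoloBlind — truncated Cauchy products with a certified remainder (kernel K-R14c)

The γ-Taylor point engine (`engL/gtaylor.py`, PLAN §126–§127) represents the two folded-chain Green functions on a
γ-cell as polynomials in the cell variable `η ∈ [-1, 1]` plus norm remainders,
`‖S(η) - ∑_{i<N} ηⁱ Cᵢ‖ ≤ r_s`, `‖R(η) - ∑_{j<N} ηʲ Dⱼ‖ ≤ r_r`, and needs the read-out products `S(η) · H · R(η)`
again in that form.  The engine computes the coefficients by the loop "`X[i+j] += Cᵢ H Dⱼ` if `i + j < N`", i.e.
`X_n = ∑_{i,j<N, i+j=n} Cᵢ H Dⱼ` (`coeff` below), and bounds everything else by norms.  This file certifies that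
bookkeeping in an arbitrary normed algebra:

* `sum_mul_mul_sum`, `double_sum_split`, `regroup` — the exact algebra: `S_N H R_N = ∑_{n<N} ηⁿ X_n + (cross terms
  with i + j ≥ N)`;
* `norm_cross_le` — for `‖η‖ ≤ 1` the cross terms are bounded by `∑_{i,j<N, i+j≥N} ‖Cᵢ‖ ‖H‖ ‖Dⱼ‖`;
* `norm_sub_trunc_le` — the abstract three-part remainder `‖S H R - T‖ ≤ ‖X‖ + ‖S - S_N‖‖H‖‖R‖ + ‖S_N‖‖H‖‖R - R_N‖`;
* `norm_prod_sub_trunc_le` — the engine's bound, uniform in `η`: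
  `‖S H R - ∑_{n<N} ηⁿ X_n‖ ≤ cross + r_s ‖H‖ (∑‖Dⱼ‖ + r_r) + (∑‖Cᵢ‖) ‖H‖ r_r`.

(Rectangular factors — `S` is `J×J`, `H` is `J×n_r`, `R` is `n_r×n_r` — embed by zero-padding into square matrices of
size `J + n_r`; products and the `∞`-operator norm are unchanged, so the square normed-ring statement suffices.)
The η-uniform envelope `|∑ ηⁿ X_n| ≤ ∑ |X_n|` used downstream is `SoloBlindGammaCell.norm_sum_pow_smul_le`.
-/

namespace Summit.AnomalousDissipation.SoloBlind.CauchyTruncation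

open Finset

section Algebra

variable {A : Type*} [Ring A]

/-- Telescoping of a product difference: `S H R - S_N H R_N = (S - S_N) H R + S_N H (R - R_N)`. -/
theorem prod_sub_prod (S SN H R RN : A) :
    S * H * R - SN * H * RN = (S - SN) * H * R + SN * H * (R - RN) := by
  noncomm_ring

/-- `(∑ aᵢ) H (∑ bⱼ) = ∑ᵢ ∑ⱼ aᵢ H bⱼ`. -/
theorem sum_mul_mul_sum (a b : ℕ → A) (H : A) (N : ℕ) :
    (∑ i ∈ range N, a i) * H * ∑ j ∈ range N, b j
      = ∑ i ∈ range N, ∑ j ∈ range N, a i * H * b j := by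
  rw [Finset.sum_mul, Finset.sum_mul]
  refine Finset.sum_congr rfl fun i _ => ?_
  rw [Finset.mul_sum]

/-- Split a double sum by the degree predicate `i + j < N`. -/
theorem double_sum_split (f : ℕ → ℕ → A) (N : ℕ) :
    ∑ i ∈ range N, ∑ j ∈ range N, f i j
      = (∑ i ∈ range N, ∑ j ∈ range N, if i + j < N then f i j else 0)
        + ∑ i ∈ range N, ∑ j ∈ range N, if N ≤ i + j then f i j else 0 := by
  rw [← Finset.sum_add_distrib]
  refine Finset.sum_congr rfl fun i _ => ?_
  rw [← Finset.sum_add_distrib]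
  refine Finset.sum_congr rfl fun j _ => ?_
  by_cases h : i + j < N
  · simp [h, not_le.mpr h]
  · simp [h, not_lt.mp h]

variable {𝕜 : Type*} [Field 𝕜] [Algebra 𝕜 A]

/-- The degree-`n` coefficient of the truncated Cauchy product, exactly as the engine accumulates it. -/
def coeff (C D : ℕ → A) (H : A) (N n : ℕ) : A :=
  ∑ i ∈ range N, ∑ j ∈ range N, if i + j = n then C i * H * D j else 0

/-- Regrouping by degree: the `i + j < N` part of `(∑ ηⁱCᵢ) H (∑ ηʲDⱼ)` is `∑_{n<N} ηⁿ X_n`. -/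
theorem regroup (C D : ℕ → A) (H : A) (N : ℕ) (η : 𝕜) :
    (∑ i ∈ range N, ∑ j ∈ range N,
        if i + j < N then (η ^ i • C i) * H * (η ^ j • D j) else 0)
      = ∑ n ∈ range N, η ^ n • coeff C D H N n := by
  unfold coeff
  simp_rw [Finset.smul_sum, smul_ite, smul_zero]
  conv_rhs => rw [Finset.sum_comm]
  refine Finset.sum_congr rfl fun i _ => ?_
  conv_rhs => rw [Finset.sum_comm]
  refine Finset.sum_congr rfl fun j _ => ?_
  rw [Finset.sum_ite_eq]
  by_cases h : i + j < N
  · simp only [h, if_true, Finset.mem_range, smul_mul_assoc, mul_smul_comm, smul_smul, ← pow_add, add_comm]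
  · simp only [h, if_false, Finset.mem_range]

end Algebra

section Normed

variable {𝕜 : Type*} [NormedField 𝕜] {A : Type*} [NormedRing A] [NormedAlgebra 𝕜 A]

/-- Cross terms (`i + j ≥ N`) are bounded by norms, uniformly in `‖η‖ ≤ 1`. -/
theorem norm_cross_le (C D : ℕ → A) (H : A) (N : ℕ) {η : 𝕜} (hη : ‖η‖ ≤ 1) :
    ‖∑ i ∈ range N, ∑ j ∈ range N,
        if N ≤ i + j then (η ^ i • C i) * H * (η ^ j • D j) else 0‖
      ≤ ∑ i ∈ range N, ∑ j ∈ range N, if N ≤ i + j then ‖C i‖ * ‖H‖ * ‖D j‖ else 0 := by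
  refine (norm_sum_le _ _).trans (Finset.sum_le_sum fun i _ => ?_)
  refine (norm_sum_le _ _).trans (Finset.sum_le_sum fun j _ => ?_)
  split_ifs with h
  · have h1 : ‖η ^ i • C i‖ ≤ ‖C i‖ := by
      rw [norm_smul, norm_pow]
      exact mul_le_of_le_one_left (norm_nonneg _) (pow_le_one₀ (norm_nonneg _) hη)
    have h2 : ‖η ^ j • D j‖ ≤ ‖D j‖ := by
      rw [norm_smul, norm_pow]
      exact mul_le_of_le_one_left (norm_nonneg _) (pow_le_one₀ (norm_nonneg _) hη)
    calc ‖(η ^ i • C i) * H * (η ^ j • D j)‖ ≤ ‖η ^ i • C i‖ * ‖H‖ * ‖η ^ j • D j‖ :=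
          (norm_mul_le _ _).trans (mul_le_mul_of_nonneg_right (norm_mul_le _ _) (norm_nonneg _))
      _ ≤ ‖C i‖ * ‖H‖ * ‖D j‖ := by gcongr
  · simp

omit [NormedAlgebra 𝕜 A] in
/-- Abstract three-part remainder: if `S_N H R_N = T + X` then
`‖S H R - T‖ ≤ ‖X‖ + ‖S - S_N‖ ‖H‖ ‖R‖ + ‖S_N‖ ‖H‖ ‖R - R_N‖`. -/
theorem norm_sub_trunc_le (S SN R RN H T X : A) (h : SN * H * RN = T + X) :
    ‖S * H * R - T‖ ≤ ‖X‖ + ‖S - SN‖ * ‖H‖ * ‖R‖ + ‖SN‖ * ‖H‖ * ‖R - RN‖ := by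
  have e : S * H * R - T = X + ((S - SN) * H * R + SN * H * (R - RN)) := by
    rw [← prod_sub_prod, h]; abel
  rw [e, add_assoc]
  refine (norm_add_le _ _).trans (add_le_add le_rfl ((norm_add_le _ _).trans (add_le_add ?_ ?_)))
  · exact (norm_mul_le _ _).trans (mul_le_mul_of_nonneg_right (norm_mul_le _ _) (norm_nonneg _))
  · exact (norm_mul_le _ _).trans (mul_le_mul_of_nonneg_right (norm_mul_le _ _) (norm_nonneg _))

/-- Sums of scaled coefficients are bounded by the coefficient norm sums when `‖η‖ ≤ 1`. -/
theorem norm_sum_pow_smul_le' (C : ℕ → A) (N : ℕ) {η : 𝕜} (hη : ‖η‖ ≤ 1) :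
    ‖∑ i ∈ range N, η ^ i • C i‖ ≤ ∑ i ∈ range N, ‖C i‖ := by
  refine (norm_sum_le _ _).trans (Finset.sum_le_sum fun i _ => ?_)
  rw [norm_smul, norm_pow]
  exact mul_le_of_le_one_left (norm_nonneg _) (pow_le_one₀ (norm_nonneg _) hη)

/-- **The engine's product remainder**, uniform over the cell `‖η‖ ≤ 1`:
`‖S H R - ∑_{n<N} ηⁿ X_n‖ ≤ cross + r_s ‖H‖ (∑ⱼ ‖Dⱼ‖ + r_r) + (∑ᵢ ‖Cᵢ‖) ‖H‖ r_r`. -/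
theorem norm_prod_sub_trunc_le (S R H : A) (C D : ℕ → A) (N : ℕ) {η : 𝕜} (hη : ‖η‖ ≤ 1)
    {rs rr : ℝ} (hS : ‖S - ∑ i ∈ range N, η ^ i • C i‖ ≤ rs)
    (hR : ‖R - ∑ j ∈ range N, η ^ j • D j‖ ≤ rr) :
    ‖S * H * R - ∑ n ∈ range N, η ^ n • coeff C D H N n‖
      ≤ (∑ i ∈ range N, ∑ j ∈ range N, if N ≤ i + j then ‖C i‖ * ‖H‖ * ‖D j‖ else 0)
        + rs * ‖H‖ * ((∑ j ∈ range N, ‖D j‖) + rr) + (∑ i ∈ range N, ‖C i‖) * ‖H‖ * rr := by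
  have hrs : 0 ≤ rs := (norm_nonneg _).trans hS
  have hrr : 0 ≤ rr := (norm_nonneg _).trans hR
  have hsplit : (∑ i ∈ range N, η ^ i • C i) * H * (∑ j ∈ range N, η ^ j • D j)
      = (∑ n ∈ range N, η ^ n • coeff C D H N n)
        + ∑ i ∈ range N, ∑ j ∈ range N,
            if N ≤ i + j then (η ^ i • C i) * H * (η ^ j • D j) else 0 := by
    rw [sum_mul_mul_sum, double_sum_split (fun i j => (η ^ i • C i) * H * (η ^ j • D j)) N, regroup]
  refine (norm_sub_trunc_le S _ R _ H _ _ hsplit).trans ?_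
  have hX := norm_cross_le C D H N hη
  have hSN : ‖∑ i ∈ range N, η ^ i • C i‖ ≤ ∑ i ∈ range N, ‖C i‖ := norm_sum_pow_smul_le' C N hη
  have hRN : ‖∑ j ∈ range N, η ^ j • D j‖ ≤ ∑ j ∈ range N, ‖D j‖ := norm_sum_pow_smul_le' D N hη
  have hRle : ‖R‖ ≤ (∑ j ∈ range N, ‖D j‖) + rr := by
    have := norm_le_norm_add_norm_sub' R (∑ j ∈ range N, η ^ j • D j)
    -- ‖R‖ ≤ ‖R_N‖ + ‖R - R_N‖
    linarith [norm_sub_rev R (∑ j ∈ range N, η ^ j • D j)]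
  have hB : 0 ≤ (∑ j ∈ range N, ‖D j‖) + rr :=
    add_nonneg (Finset.sum_nonneg fun _ _ => norm_nonneg _) hrr
  gcongr

end Normed

end Summit.AnomalousDissipation.SoloBlind.CauchyTruncation
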